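import Mathlib.Algebra.Order.Archimedean.Real.Basic
import Mathlib.Combinatorics.SimpleGraph.Maps
import Literature.Combinatorics.SimpleGraph.LasserreLevelOne
import HarnessLib

/-!
# Lasserre's bound `las⁽ᵗ⁾(G)`: junk level `0`, level-`1` clique-cover bound, isomorphism invariance

Complements to `LasserreStableBound.lean` / `LasserreLevelOne.lean` (Laurent 2006, program (22)),
all PROVED, folklore:

* `lasserreStableBound_zero` — at level `t = 0` the program constrains nothing, the values
  `Σ_v y_v` fill `{|V|·c}` and the real supremum is the junk value `0` (documented but not proved in
  `LasserreStableBound.lean`); this is why every bound lemma there carries `1 ≤ t`.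
* `IsLasserreFeasible.sum_clique_le_one` — the level-`1` CLIQUE INEQUALITY `Σ_{v ∈ K} y_v ≤ 1` for a
  clique `K` (test `M_1(y) ⪰ 0` at `x_∅ = 1`, `x_v = −[v ∈ K]`); hence
  `lasserreStableBound_le_card_of_cliqueCover` (`las⁽ᵗ⁾(G) ≤ m` when `V` is covered by `m` cliques,
  the SDP shadow of `α ≤ χ̄`) and `lasserreStableBound_top_le_one` (`las⁽ᵗ⁾(K_n) ≤ 1`).
* `lasserreStableBound_le_of_iso`, `lasserreStableBound_eq_of_iso` — invariance under graph
  isomorphisms (pull a feasible `y` back along `φ`; the moment matrix is reindexed).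

Written for the refuter analysis of `Summit.PneNP.PneNP.Theses.RamseyUncertifiable.PaleySosRung`
(stmt-PneNP-9817): the clique-cover bound kills the crux's variants without `p ≡ 1 (mod 4)` or
without primality, and isomorphism invariance transports `las⁽ᵗ⁾` along the self-complementarity of
the Paley graph (`PaleySelfComplementary.lean`).

## References

* [Laurent2006] M. Laurent, Math. Program. 109 (2007), §3.1, program (22), p. 248.
-/

namespace Literature.Combinatorics.SimpleGraph

open Matrix Finset

noncomputable section

section General

variable {V : Type*} [Fintype V] [DecidableEq V]

/-- **Level `0` is junk**: `las⁽⁰⁾(G) = 0` for every finite graph (the value set contains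
`{|V|·c : c ∈ ℝ}`: unbounded when `V ≠ ∅`, and `{0}` when `V = ∅`; `Real.sSup` of an unbounded
set is `0`). [folklore] -/
theorem lasserreStableBound_zero (G : SimpleGraph V) : lasserreStableBound G 0 = 0 := by
  have hfeas : ∀ c : ℝ, IsLasserreFeasible G 0
      (fun S => if S = ∅ then 1 else if S.card = 1 then c else 0) := by
    intro c
    refine ⟨by simp, fun u v huv => ?_, ?_⟩
    · have hne := G.ne_of_adj huv
      have h2 : ({u, v} : Finset V).card = 2 := card_pair hne
      have hne' : ({u, v} : Finset V) ≠ ∅ := by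
        intro h; rw [h] at h2; simp at h2
      simp [hne', h2]
    · have hI : ∀ I : {S : Finset V // S.card ≤ 0}, I.1 = ∅ := fun I =>
        Finset.card_eq_zero.1 (Nat.le_zero.1 I.2)
      have hM : momentMatrix 0
          (fun S : Finset V => if S = ∅ then (1 : ℝ) else if S.card = 1 then c else 0) =
          vecMulVec (fun _ => (1 : ℝ)) (star fun _ => (1 : ℝ)) := by
        ext I J
        simp [momentMatrix_apply, hI I, hI J, vecMulVec_apply]
      rw [hM]
      exact posSemidef_vecMulVec_self_star _
  have hval : ∀ c : ℝ, (Fintype.card V : ℝ) * c ∈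
      (fun y : Finset V → ℝ => ∑ v, y {v}) '' {y | IsLasserreFeasible G 0 y} := by
    intro c
    refine ⟨_, hfeas c, ?_⟩
    simp
  rcases isEmpty_or_nonempty V with hV | hV
  · rw [lasserreStableBound]
    have hset : (fun y : Finset V → ℝ => ∑ v, y {v}) '' {y | IsLasserreFeasible G 0 y} = {0} := by
      refine Set.eq_singleton_iff_unique_mem.2 ⟨?_, ?_⟩
      · simpa using hval 0
      · rintro _ ⟨y, -, rfl⟩
        simp
    rw [hset, csSup_singleton]
  · rw [lasserreStableBound]
    apply Real.sSup_of_not_bddAbove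
    rintro ⟨b, hb⟩
    have hcard : (0 : ℝ) < Fintype.card V := by exact_mod_cast Fintype.card_pos
    have h := hb (hval (b / Fintype.card V + 1))
    rw [mul_add, mul_div_cancel₀ _ hcard.ne', mul_one] at h
    linarith

/-- **Clique inequality at level `1`**: for a level-`1` feasible `y` and a clique `K` of `G`,
`Σ_{v ∈ K} y_v ≤ 1` (test `M_1(y) ⪰ 0` at `x_∅ = 1`, `x_v = −[v ∈ K]`: the form is `1 − Σ_K y_v`,
the cross terms `y_{uv}`, `u ≠ v ∈ K`, vanishing on the edges). [folklore] -/
theorem IsLasserreFeasible.sum_clique_le_one {G : SimpleGraph V} {y : Finset V → ℝ}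
    (hy : IsLasserreFeasible G 1 y) (K : Finset V) (hK : G.IsClique (K : Set V)) :
    ∑ v ∈ K, y {v} ≤ 1 := by
  set x : Option V → ℝ := fun o => o.elim (1 : ℝ) fun v => if v ∈ K then -1 else 0 with hx
  have hpsd := hy.posSemidef.submatrix (levelOneIndex (V := V))
  have h := hpsd.dotProduct_mulVec_nonneg x
  rw [star_trivial] at h
  -- the inner sums
  have hpair : ∀ u ∈ K, ∑ v ∈ K, y ({u} ∪ {v}) = y {u} := by
    intro u hu
    rw [Finset.sum_eq_single_of_mem u hu]
    · simp
    · intro v hv hvu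
      rw [← insert_eq]
      exact hy.pair_eq_zero (hK (mem_coe.2 hu) (mem_coe.2 hv) (Ne.symm hvu))
  have hexp : x ⬝ᵥ ((momentMatrix 1 y).submatrix levelOneIndex levelOneIndex *ᵥ x) =
      1 - ∑ v ∈ K, y {v} := by
    have hxn : x none = 1 := rfl
    have hxs : ∀ u, x (some u) = if u ∈ K then -1 else 0 := fun u => rfl
    have hrow_none : ((momentMatrix 1 y).submatrix levelOneIndex levelOneIndex *ᵥ x) none =
        1 - ∑ v ∈ K, y {v} := by
      simp only [mulVec, dotProduct, Fintype.sum_option, submatrix_apply, momentMatrix_apply,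
        levelOneIndex_none_val, levelOneIndex_some_val, hxn, hxs, empty_union,
        hy.empty_eq_one, mul_one, mul_ite, mul_neg, mul_zero]
      rw [Finset.sum_ite_mem, univ_inter, Finset.sum_neg_distrib]
      ring
    have hrow_some : ∀ u, ((momentMatrix 1 y).submatrix levelOneIndex levelOneIndex *ᵥ x) (some u) =
        y {u} - ∑ v ∈ K, y ({u} ∪ {v}) := by
      intro u
      simp only [mulVec, dotProduct, Fintype.sum_option, submatrix_apply, momentMatrix_apply,
        levelOneIndex_none_val, levelOneIndex_some_val, hxn, hxs, union_empty, mul_one, mul_ite,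
        mul_neg, mul_zero]
      rw [Finset.sum_ite_mem, univ_inter, Finset.sum_neg_distrib]
      ring
    rw [dotProduct, Fintype.sum_option, hrow_none, hxn, one_mul]
    suffices hz : ∑ u, x (some u) *
        ((momentMatrix 1 y).submatrix levelOneIndex levelOneIndex *ᵥ x) (some u) = 0 by
      rw [hz, add_zero]
    refine Finset.sum_eq_zero fun u _ => ?_
    rw [hrow_some, hxs]
    split_ifs with hu
    · rw [hpair u hu]; ring
    · ring
  rw [hexp] at h
  linarith

/-- **Clique-cover bound**: if the vertices are coloured by `ι` so that distinct vertices of the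
same colour are adjacent (each colour class is a clique), then `las⁽ᵗ⁾(G) ≤ |ι|` for `t ≥ 1`.
[folklore] -/
theorem lasserreStableBound_le_card_of_cliqueCover {ι : Type*} [Fintype ι] [DecidableEq ι]
    (G : SimpleGraph V) (c : V → ι) (hc : ∀ u v, u ≠ v → c u = c v → G.Adj u v) {t : ℕ}
    (ht : 1 ≤ t) : lasserreStableBound G t ≤ Fintype.card ι := by
  refine (lasserreStableBound_anti_level le_rfl ht).trans ?_
  refine lasserreStableBound_le_of_forall fun y hy => ?_
  rw [← Finset.sum_fiberwise Finset.univ c fun v => y {v}]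
  calc ∑ i, ∑ v ∈ Finset.univ.filter (fun v => c v = i), y {v} ≤ ∑ _i : ι, (1 : ℝ) := by
        refine Finset.sum_le_sum fun i _ => hy.sum_clique_le_one _ ?_
        intro u hu v hv huv
        rw [mem_coe, mem_filter] at hu hv
        exact hc u v huv (hu.2.trans hv.2.symm)
    _ = Fintype.card ι := by simp

/-- The complete graph: `las⁽ᵗ⁾(K_V) ≤ 1` for `t ≥ 1`. [folklore] -/
theorem lasserreStableBound_top_le_one {t : ℕ} (ht : 1 ≤ t) :
    lasserreStableBound (⊤ : SimpleGraph V) t ≤ 1 := by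
  have h := lasserreStableBound_le_card_of_cliqueCover (⊤ : SimpleGraph V) (fun _ => ())
    (fun u v huv _ => (SimpleGraph.top_adj u v).2 huv) ht
  simpa using h

end General

/-! ### Isomorphism invariance -/

/-- `las⁽ᵗ⁾` is monotone along graph isomorphisms (pull back a feasible `y` of `G'` to
`S ↦ y (φ '' S)`; the moment matrix becomes a reindexing). [folklore] -/
theorem lasserreStableBound_le_of_iso {V W : Type*} [Fintype V] [DecidableEq V] [Fintype W]
    [DecidableEq W] {G : SimpleGraph V} {G' : SimpleGraph W} (φ : G ≃g G') {t : ℕ} (ht : 1 ≤ t) :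
    lasserreStableBound G' t ≤ lasserreStableBound G t := by
  refine lasserreStableBound_le_of_forall fun y hy => ?_
  set y' : Finset V → ℝ := fun S => y (S.map φ.toEquiv.toEmbedding) with hy'def
  have hy' : IsLasserreFeasible G t y' := by
    refine ⟨?_, ?_, ?_⟩
    · simp [hy'def, hy.empty_eq_one]
    · intro u v huv
      simp only [hy'def, Finset.map_insert, Finset.map_singleton, Equiv.coe_toEmbedding]
      exact hy.pair_eq_zero (φ.map_adj_iff.2 huv)
    · have hM : momentMatrix t y' = (momentMatrix t y).submatrix
          (fun I : {S : Finset V // S.card ≤ t} =>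
            (⟨I.1.map φ.toEquiv.toEmbedding, by rw [Finset.card_map]; exact I.2⟩ :
              {S : Finset W // S.card ≤ t}))
          (fun I => ⟨I.1.map φ.toEquiv.toEmbedding, by rw [Finset.card_map]; exact I.2⟩) := by
        ext I J
        simp [momentMatrix_apply, hy'def, Finset.map_union]
      rw [hM]
      exact hy.posSemidef.submatrix _
  have hval : ∑ v, y' {v} = ∑ w, y {w} := by
    simp only [hy'def, Finset.map_singleton, Equiv.coe_toEmbedding]
    exact φ.toEquiv.sum_comp (fun w => y {w})
  rw [← hval]
  exact hy'.sum_singleton_le_lasserreStableBound ht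

/-- `las⁽ᵗ⁾` is an isomorphism invariant (`t ≥ 1`). [folklore] -/
theorem lasserreStableBound_eq_of_iso {V W : Type*} [Fintype V] [DecidableEq V] [Fintype W]
    [DecidableEq W] {G : SimpleGraph V} {G' : SimpleGraph W} (φ : G ≃g G') {t : ℕ} (ht : 1 ≤ t) :
    lasserreStableBound G t = lasserreStableBound G' t :=
  le_antisymm (lasserreStableBound_le_of_iso φ.symm ht) (lasserreStableBound_le_of_iso φ ht)

end

end Literature.Combinatorics.SimpleGraph
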